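import Mathlib.Algebra.Algebra.Subalgebra.Basic
import Mathlib.Algebra.BigOperators.GroupWithZero.Finset
import Mathlib.Algebra.BigOperators.Ring.Finset
import Mathlib.Data.Complex.Basic
import Mathlib.Data.Matrix.Basic
import Mathlib.Data.Matrix.Mul
import Mathlib.LinearAlgebra.LinearIndependent.Defs
import Mathlib.LinearAlgebra.Span.Defs
import Mathlib.Logic.Equiv.Fin.Basic
import Mathlib.SetTheory.Cardinal.Finite
import Literature.Computability.QuantumComplexity.StabilizerRank
import HarnessLib

/-!
# Stochastic Lagrangian subspaces and the Clifford code operators `r(T)`, `R(T) = r(T)^{⊗n}`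

Definition request `defn-cliffordCodeOperator` (route QuantumAdvantage/CodeFlattening, items
`DegreeOneCommutantBlind`, `SingleCodeDegreeOneBlind`, which inline these notions). Qubit case
(`d = 2`) of §4.1 of Gross–Nezami–Walter, over the tree's registers `QReg t = Fin t → Bool`
(`Literature/Computability/Cryptography/QubitRegister.lean`) and Clifford circuits
`cliffordCircuits n` (`StabilizerRank.lean`):

* `IsStochasticLagrangian T` — `T ⊆ 𝔽₂^t × 𝔽₂^t` (a `Finset (QReg t × QReg t)`) is a
  *stochastic Lagrangian subspace*, `T ∈ Σ_{t,t}(2)` [GNW21, Def. 4.1]: a subspace (closed under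
  coordinatewise xor) of dimension `t` (`|T| = 2^t`), totally isotropic for the `ℤ/4`-valued
  quadratic form `𝔮(x, y) = x·x − y·y = |x| − |y| (mod 4)` (Hamming weights agree mod `4`), and
  stochastic (`1_{2t} = (1…1, 1…1) ∈ T`; for qubits this follows from the other conditions,
  [GNW21, Remark 4.2], but it is part of the printed definition and is kept);
* `codeOperator T = r(T) = Σ_{(x,y) ∈ T} |x⟩⟨y|`, the `0/1` matrix of `T` on `(ℂ²)^{⊗t}`
  [GNW21, §4.1, display before Def. 4.1];
* `cliffordCodeOperator T n = R(T) = r(T)^{⊗n}` acting on `t` copies of an `n`-qubit register,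
  realised on `QReg (t * n)` with the wire of (copy `j`, qubit `i`) at `finProdFinEquiv (j, i)`
  (the layout used by the requesting route): entry `(x, y) ↦ ∏_{i<n} [(x_{·,i}, y_{·,i}) ∈ T]`;
* `tensorPowerAction t C = C^{⊗t}`, the `t`-th tensor power (diagonal) action of an `n`-qubit
  operator in the same layout, a monoid homomorphism (`tensorPowerActionHom`), and
  `cliffordCommutant t n`, the commutant of `{C^{⊗t} : C ∈ cliffordCircuits n}` (a subalgebra);
* the permutation subspaces `permCode π = T_π = {(π·y, y)}` (`S_t ⊆ Σ_{t,t}`,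
  [GNW21, §4.1, eq. for `r_π`]), giving `r(T_1) = 1`, `R(T_1) = 1` (non-vacuity);
* the left/right defect subspaces `leftDefect T = T_{LD} = {x : (x,0) ∈ T}`,
  `rightDefect T = T_{RD} = {y : (0,y) ∈ T}` [GNW21, §4.2, "defect subspaces"];
* the NAMED FACT `CliffordCommutantTheorem` [GNW21, Thm. 4.3 (= Thm. 1.1 of the
  introduction), case `d = 2`]: for `n ≥ t − 1` the `R(T)`, `T ∈ Σ_{t,t}(2)`, are
  `∏_{k=0}^{t-2} (2^k + 1)` linearly independent operators spanning the commutant.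

## Sources

* [GNW21] D. Gross, S. Nezami, M. Walter, *Schur–Weyl duality for the Clifford group with
  applications: property testing, a robust Hudson theorem, and de Finetti representations*,
  Comm. Math. Phys. 385 (2021) 1325–1393, arXiv:1712.08628, §4.1 (Def. 4.1, Thm. 4.3,
  Lemma 4.5, Lemma 4.7, Thms. 4.9–4.10), §4.2 (defect subspaces). Bib key `GrossNezamiWalter2021`.
  Numbering is that of the published version (corroborated by M. Hinsche, J. Helsen,
  *Single-copy stabilizer testing*, Thm. 2.23 = "Theorem 4.3 in [GNW]", Fact 2.26 =
  "Theorem 4.10 in [GNW]").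
* G. Nebe, E. M. Rains, N. J. A. Sloane, *Self-dual codes and invariant theory* (2006) — the
  coding-theory origin of the operators `R(T)` (cf. [GNW21, Remark 4.4]).

## Design choices

* Only qubits (`d = 2`, `D = 4`): the requesting route and the tree's registers are Boolean. The
  general prime-`d` theory (`𝔮` valued in `ℤ/D`, `D ∈ {d, 2d}`) is not set up here.
* Subspaces of `𝔽₂^{2t}` are encoded as `Finset`s of pairs of Boolean strings closed under xor
  (with `|T| = 2^t` expressing `dim T = t`), literally the inline encoding of the route items, so
  that those items are restated by unfolding; no `ZMod 2`-module structure is imposed.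
* `R(T)` is defined directly by its matrix entries (a product over qubits of entries of `r(T)`,
  `cliffordCodeOperator_apply_eq_prod`), not via iterated Kronecker products, to match the route's
  wire layout `finProdFinEquiv (j, i)`; `copies`/`slices` are the register equivalences
  `QReg (t*n) ≃ (Fin t → QReg n)` / `≃ (Fin n → QReg t)` behind this layout.
* The commutant is taken with respect to the monoid `cliffordCircuits n` generated by placements
  of `H, S, CNOT` (no global phases); since phases are scalar and commutants are insensitive to
  passing to the generated group, this is the commutant of the `t`-th tensor power of the
  `n`-qubit Clifford group of [GNW21].
* NOT here: Lemma 4.5 (`R(T)` commutes with `C^{⊗t}`; provable, deferred to a separate file),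
  Lemma 4.23 (rank of `r(T)` via defect subspaces), the stochastic orthogonal group `O_t(2)`,
  and any proof of `CliffordCommutantTheorem` (a named fact, D-0014).
* Mathlib has no stabilizer/Clifford commutant theory (searched `Lagrangian`, `selfDual`,
  `codeOperator`, `Nezami`, `commutant`); used: `Matrix.of`, `finProdFinEquiv`,
  `Subalgebra.centralizer`, `LinearIndependent`, `Submodule.span`, `Nat.card`.
-/

noncomputable section

open Matrix

namespace Literature.Computability.QuantumComplexity

open Cryptography (QReg)

variable {t n : ℕ}

/-! ### Register layout: `t` copies of `n` qubits inside `QReg (t * n)` -/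

/-- The rows of the layout: `x ↦ (j ↦ (i ↦ x (finProdFinEquiv (j, i))))`, an equivalence
`QReg (t * n) ≃ (Fin t → QReg n)` reading off the `n`-qubit register of each copy `j < t`
(`((ℂ²)^{⊗n})^{⊗t}` picture of [GNW21, §4.1]). [folklore] -/
def copies (t n : ℕ) : QReg (t * n) ≃ (Fin t → QReg n) where
  toFun x j i := x (finProdFinEquiv (j, i))
  invFun X k := X (finProdFinEquiv.symm k).1 (finProdFinEquiv.symm k).2
  left_inv x := funext fun k => congrArg x (finProdFinEquiv.apply_symm_apply k)
  right_inv X := by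
    funext j i
    simp

/-- The columns of the layout: `x ↦ (i ↦ (j ↦ x (finProdFinEquiv (j, i))))`, an equivalence
`QReg (t * n) ≃ (Fin n → QReg t)` reading off, for each qubit `i < n`, its `t` copies
(`((ℂ²)^{⊗t})^{⊗n}` picture of [GNW21, §4.1]). [folklore] -/
def slices (t n : ℕ) : QReg (t * n) ≃ (Fin n → QReg t) where
  toFun x i j := x (finProdFinEquiv (j, i))
  invFun X k := X (finProdFinEquiv.symm k).2 (finProdFinEquiv.symm k).1
  left_inv x := funext fun k => congrArg x (finProdFinEquiv.apply_symm_apply k)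
  right_inv X := by
    funext i j
    simp

/-- Unfolding `copies`: copy `j` of `x` is `i ↦ x (finProdFinEquiv (j, i))`. [folklore] -/
@[simp] theorem copies_apply (x : QReg (t * n)) (j : Fin t) :
    copies t n x j = fun i => x (finProdFinEquiv (j, i)) := rfl

/-- Unfolding `slices`: the `t` copies of qubit `i` of `x` are `j ↦ x (finProdFinEquiv (j, i))`.
[folklore] -/
@[simp] theorem slices_apply (x : QReg (t * n)) (i : Fin n) :
    slices t n x i = fun j => x (finProdFinEquiv (j, i)) := rfl

/-- Two registers agree iff all their qubit columns agree. [folklore] -/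
theorem eq_iff_forall_slices_eq {x y : QReg (t * n)} :
    x = y ↔ ∀ i : Fin n, (fun j => x (finProdFinEquiv (j, i))) = (fun j => y (finProdFinEquiv (j, i))) := by
  constructor
  · rintro rfl i
    rfl
  · intro h
    funext k
    obtain ⟨⟨j, i⟩, rfl⟩ := finProdFinEquiv.surjective k
    exact congrFun (h i) j

/-- Two registers agree iff all their copies agree. [folklore] -/
theorem eq_iff_forall_copies_eq {x y : QReg (t * n)} :
    x = y ↔ ∀ j : Fin t, (fun i => x (finProdFinEquiv (j, i))) = (fun i => y (finProdFinEquiv (j, i))) := by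
  constructor
  · rintro rfl j
    rfl
  · intro h
    funext k
    obtain ⟨⟨j, i⟩, rfl⟩ := finProdFinEquiv.surjective k
    exact congrFun (h j) i

/-! ### Stochastic Lagrangian subspaces `Σ_{t,t}(2)` -/

/-- **Stochastic Lagrangian subspaces** `Σ_{t,t}(2)` (qubit case of [GNW21, Def. 4.1]). A set
`T ⊆ 𝔽₂^t × 𝔽₂^t` of pairs of Boolean strings is a stochastic Lagrangian subspace if

* `card_eq`: `|T| = 2^t`, i.e. (given that `T` is a subspace) `dim T = t`, "the maximal possible
  dimension";
* `one_mem`: `T` is *stochastic*: `1_{2t} = (1…1, 1…1) ∈ T`;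
* `xor_mem`: `T` is a subspace of `𝔽₂^{2t}`: closed under coordinatewise addition (xor); with
  `one_mem` this gives `0 ∈ T` (`IsStochasticLagrangian.zero_mem`);
* `weight_mod_four`: `T` is *totally `𝔮`-isotropic* for `𝔮(x, y) = x·x − y·y ∈ ℤ/4`, i.e. the
  Hamming weights satisfy `|x| ≡ |y| (mod 4)` for all `(x, y) ∈ T` (for a `0/1`-vector,
  `x·x = |x|` is well defined modulo `4`).

The first and last two conditions say that `T` is *Lagrangian*. For `d = 2` a Lagrangian `T` is
automatically stochastic [GNW21, Remark 4.2]; the condition is kept as printed. The field order and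
form are literally those inlined by route QuantumAdvantage/CodeFlattening.
[cite: GrossNezamiWalter2021, Def. 4.1] -/
structure IsStochasticLagrangian (T : Finset (QReg t × QReg t)) : Prop where
  /-- `|T| = 2^t` (`dim T = t`). -/
  card_eq : T.card = 2 ^ t
  /-- `T` is stochastic: `(1…1, 1…1) ∈ T`. -/
  one_mem : ((fun _ => true), (fun _ => true)) ∈ T
  /-- `T` is closed under coordinatewise xor (a subspace of `𝔽₂^{2t}`). -/
  xor_mem : ∀ p ∈ T, ∀ q ∈ T,
    ((fun j => Bool.xor (p.1 j) (q.1 j)), (fun j => Bool.xor (p.2 j) (q.2 j))) ∈ T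
  /-- `T` is totally `𝔮`-isotropic: `|x| ≡ |y| (mod 4)` for `(x, y) ∈ T`. -/
  weight_mod_four : ∀ p ∈ T,
    (Finset.univ.filter fun j => p.1 j = true).card % 4 =
      (Finset.univ.filter fun j => p.2 j = true).card % 4

/-- `IsStochasticLagrangian T` unfolded as the conjunction inlined by the route items
(`T.card = 2 ^ t ∧ (1,1) ∈ T ∧ xor-closed ∧ weights agree mod 4`). [folklore] -/
theorem isStochasticLagrangian_iff (T : Finset (QReg t × QReg t)) :
    IsStochasticLagrangian T ↔
      T.card = 2 ^ t ∧ ((fun _ => true), (fun _ => true)) ∈ T ∧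
      (∀ p ∈ T, ∀ q ∈ T,
        ((fun j => Bool.xor (p.1 j) (q.1 j)), (fun j => Bool.xor (p.2 j) (q.2 j))) ∈ T) ∧
      (∀ p ∈ T, (Finset.univ.filter fun j => p.1 j = true).card % 4 =
        (Finset.univ.filter fun j => p.2 j = true).card % 4) :=
  ⟨fun h => ⟨h.card_eq, h.one_mem, h.xor_mem, h.weight_mod_four⟩,
    fun h => ⟨h.1, h.2.1, h.2.2.1, h.2.2.2⟩⟩

namespace IsStochasticLagrangian

variable {T : Finset (QReg t × QReg t)}

/-- A stochastic Lagrangian subspace contains `0 = 1_{2t} + 1_{2t}`. [folklore] -/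
theorem zero_mem (hT : IsStochasticLagrangian T) : ((fun _ => false), (fun _ => false)) ∈ T := by
  simpa using hT.xor_mem _ hT.one_mem _ hT.one_mem

/-- A stochastic Lagrangian subspace is closed under complementing both strings
(`v ↦ v + 1_{2t}`). [folklore] -/
theorem compl_mem (hT : IsStochasticLagrangian T) {p : QReg t × QReg t} (hp : p ∈ T) :
    ((fun j => !(p.1 j)), (fun j => !(p.2 j))) ∈ T := by
  simpa using hT.xor_mem _ hp _ hT.one_mem

/-- `Σ_{t,t}` is invariant under swapping the two factors (`T ↦ {(y, x) : (x, y) ∈ T}`, the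
transpose `r(T) ↦ r(T)ᵀ`). [folklore] -/
theorem swap (hT : IsStochasticLagrangian T) :
    IsStochasticLagrangian (T.map (Equiv.prodComm (QReg t) (QReg t)).toEmbedding) := by
  refine ⟨?_, ?_, ?_, ?_⟩
  · rw [Finset.card_map, hT.card_eq]
  · rw [Finset.mem_map_equiv]
    exact hT.one_mem
  · intro p hp q hq
    rw [Finset.mem_map_equiv] at hp hq ⊢
    exact hT.xor_mem _ hp _ hq
  · intro p hp
    rw [Finset.mem_map_equiv] at hp
    exact (hT.weight_mod_four _ hp).symm

end IsStochasticLagrangian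

/-! ### The code operators `r(T)` and `R(T) = r(T)^{⊗n}` -/

/-- The operator `r(T) = Σ_{(x,y) ∈ T} |x⟩⟨y|` on `(ℂ²)^{⊗t}` attached to `T ⊆ 𝔽₂^t × 𝔽₂^t`:
the `0/1` matrix with entry `1` at `(x, y)` iff `(x, y) ∈ T` (a real matrix in the computational
basis). [cite: GrossNezamiWalter2021, §4.1 (definition of r(T), before Def. 4.1)] -/
def codeOperator (T : Finset (QReg t × QReg t)) : Matrix (QReg t) (QReg t) ℂ :=
  Matrix.of fun x y => if (x, y) ∈ T then 1 else 0

/-- Entries of `r(T)`: `⟨x| r(T) |y⟩ = [(x, y) ∈ T]`. [cite: GrossNezamiWalter2021, §4.1 (definition of r(T))] -/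
@[simp] theorem codeOperator_apply (T : Finset (QReg t × QReg t)) (x y : QReg t) :
    codeOperator T x y = if (x, y) ∈ T then 1 else 0 := rfl

/-- **The Clifford code operator** `R(T) = r(T)^{⊗n}` on `((ℂ²)^{⊗n})^{⊗t} ≅ ((ℂ²)^{⊗t})^{⊗n}`,
realised on the register `QReg (t * n)` with (copy `j`, qubit `i`) at wire `finProdFinEquiv (j, i)`:
its `(x, y)` entry is `∏_{i<n} [(x_{·,i}, y_{·,i}) ∈ T]`, the product over qubits of the entries of
`r(T)` at the `i`-th columns (`cliffordCodeOperator_apply_eq_prod`). For `T ∈ Σ_{t,t}(2)` these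
operators commute with `C^{⊗t}` for every Clifford `C` [GNW21, Lemma 4.5] and, for `n ≥ t-1`,
form a basis of the commutant [GNW21, Thm. 4.3] (`CliffordCommutantTheorem`). The body is
literally the matrix inlined by route QuantumAdvantage/CodeFlattening.
[cite: GrossNezamiWalter2021, §4.1 (R(T) = r(T)^{⊗n}) and Thm. 4.3] -/
def cliffordCodeOperator (T : Finset (QReg t × QReg t)) (n : ℕ) :
    Matrix (QReg (t * n)) (QReg (t * n)) ℂ :=
  Matrix.of fun x y => ∏ i : Fin n,
    if ((fun j => x (finProdFinEquiv (j, i))), (fun j => y (finProdFinEquiv (j, i)))) ∈ T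
    then (1 : ℂ) else 0

/-- Entries of `R(T)` (definitional unfolding). [cite: GrossNezamiWalter2021, §4.1 (R(T) = r(T)^{⊗n})] -/
@[simp] theorem cliffordCodeOperator_apply (T : Finset (QReg t × QReg t)) (n : ℕ)
    (x y : QReg (t * n)) :
    cliffordCodeOperator T n x y = ∏ i : Fin n,
      if ((fun j => x (finProdFinEquiv (j, i))), (fun j => y (finProdFinEquiv (j, i)))) ∈ T
      then (1 : ℂ) else 0 := rfl

/-- `R(T) = r(T)^{⊗n}` in coordinates: the `(x, y)` entry of `R(T)` is the product over the
qubits `i` of the entries of `r(T)` at the `i`-th columns of `x` and `y`.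
[cite: GrossNezamiWalter2021, §4.1 (R(T) = r(T)^{⊗n})] -/
theorem cliffordCodeOperator_apply_eq_prod (T : Finset (QReg t × QReg t)) (n : ℕ)
    (x y : QReg (t * n)) :
    cliffordCodeOperator T n x y = ∏ i : Fin n, codeOperator T (slices t n x i) (slices t n y i) :=
  rfl

/-- The `0/1` pattern of `R(T)`: the entry is `1` if every column pair lies in `T` and `0`
otherwise. [folklore] -/
theorem cliffordCodeOperator_apply_eq_ite (T : Finset (QReg t × QReg t)) (n : ℕ)
    (x y : QReg (t * n)) :
    cliffordCodeOperator T n x y =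
      if ∀ i : Fin n, (slices t n x i, slices t n y i) ∈ T then 1 else 0 := by
  rw [cliffordCodeOperator_apply_eq_prod]
  split_ifs with h
  · exact Finset.prod_eq_one fun i _ => by simp only [codeOperator_apply, h i, if_true]
  · push Not at h
    obtain ⟨i, hi⟩ := h
    exact Finset.prod_eq_zero (Finset.mem_univ i) (by simp only [codeOperator_apply, hi, if_false])

/-- For a single copy-block (`n = 1`), `R(T)` is `r(T)` transported along
`QReg t ≃ QReg (t * 1)`. [cite: GrossNezamiWalter2021, §4.1 (R(T) = r(T)^{⊗n}, n = 1)] -/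
theorem cliffordCodeOperator_one (T : Finset (QReg t × QReg t)) :
    cliffordCodeOperator T 1 =
      Matrix.reindex ((slices t 1).trans (Equiv.funUnique (Fin 1) (QReg t))).symm
        ((slices t 1).trans (Equiv.funUnique (Fin 1) (QReg t))).symm (codeOperator T) := by
  ext x y
  simp [Fin.default_eq_zero]

/-- `r(T)ᵀ = r(Tˢʷᵃᵖ)`: transposing `r(T)` swaps the two factors of `T`. [folklore] -/
theorem codeOperator_transpose (T : Finset (QReg t × QReg t)) :
    (codeOperator T)ᵀ = codeOperator (T.map (Equiv.prodComm (QReg t) (QReg t)).toEmbedding) := by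
  ext x y
  simp [Finset.mem_map_equiv]

/-- `⟨0^{tn}| R(T) |0^{tn}⟩ = 1` for `T ∈ Σ_{t,t}` (since `0 ∈ T`); with Lemma 4.5 this gives
`⟨S|^{⊗t} R(T) |S⟩^{⊗t} = 1` for every stabilizer state.
[cite: GrossNezamiWalter2021, §4.1 (display after the proof of Thm. 4.3)] -/
theorem cliffordCodeOperator_apply_zero_zero {T : Finset (QReg t × QReg t)}
    (hT : IsStochasticLagrangian T) (n : ℕ) :
    cliffordCodeOperator T n (fun _ => false) (fun _ => false) = 1 := by
  simp [hT.zero_mem]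

/-! ### Permutation subspaces `T_π` (`S_t ⊆ Σ_{t,t}`) -/

/-- The permutation subspace `T_π = {(π·y, y) : y ∈ 𝔽₂^t}` with `(π·y)_i = y_{π⁻¹ i}`, for which
`r(T_π) = r_π` is the permutation of tensor factors; `S_t ⊆ Σ_{t,t}(d)`.
[cite: GrossNezamiWalter2021, §4.1 (T_π, discussion after Thm. 4.3)] -/
def permCode (π : Equiv.Perm (Fin t)) : Finset (QReg t × QReg t) :=
  Finset.univ.image fun y : QReg t => (y ∘ π.symm, y)

/-- Membership in `T_π`: `(x, y) ∈ T_π ↔ x = π·y` (`(π·y)_i = y_{π⁻¹ i}`).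
[cite: GrossNezamiWalter2021, §4.1 (T_π)] -/
theorem mem_permCode {π : Equiv.Perm (Fin t)} {p : QReg t × QReg t} :
    p ∈ permCode π ↔ p.1 = p.2 ∘ π.symm := by
  simp only [permCode, Finset.mem_image, Finset.mem_univ, true_and]
  constructor
  · rintro ⟨y, rfl⟩
    rfl
  · intro h
    exact ⟨p.2, Prod.ext h.symm rfl⟩

/-- Hamming weight is invariant under permuting coordinates. [folklore] -/
theorem card_filter_comp_perm (y : QReg t) (π : Equiv.Perm (Fin t)) :
    (Finset.univ.filter fun j => (y ∘ π.symm) j = true).card =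
      (Finset.univ.filter fun j => y j = true).card := by
  refine Finset.card_bij (fun j _ => π.symm j) (fun j hj => by simpa using hj)
    (fun a _ b _ h => π.symm.injective h) (fun b hb => ⟨π b, by simpa using hb, by simp⟩)

/-- Every permutation subspace is a stochastic Lagrangian subspace (`S_t ⊆ Σ_{t,t}(2)`); in
particular `Σ_{t,t}(2)` is nonempty. [cite: GrossNezamiWalter2021, §4.1 (S_t ⊆ Σ_{t,t}, after Thm. 4.3)] -/
theorem isStochasticLagrangian_permCode (π : Equiv.Perm (Fin t)) :
    IsStochasticLagrangian (permCode π) := by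
  refine ⟨?_, ?_, ?_, ?_⟩
  · rw [permCode, Finset.card_image_of_injective _ fun y y' h => (Prod.ext_iff.1 h).2]
    simp
  · rw [mem_permCode]
    rfl
  · intro p hp q hq
    rw [mem_permCode] at hp hq ⊢
    funext j
    simp [hp, hq]
  · intro p hp
    rw [mem_permCode] at hp
    rw [hp, card_filter_comp_perm]

/-- `r(T_1) = 1`: the diagonal subspace `Δ = T_1 = {(y, y)}` gives the identity.
[cite: GrossNezamiWalter2021, §4.1 (r_π for π = 1)] -/
@[simp] theorem codeOperator_permCode_one : codeOperator (permCode (1 : Equiv.Perm (Fin t))) = 1 := by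
  ext x y
  simp [mem_permCode, Matrix.one_apply, Equiv.Perm.one_def]

/-- `R(T_1) = 1 ^{⊗n} = 1`. [cite: GrossNezamiWalter2021, §4.1 (R(T_π) is the permutation action, π = 1)] -/
@[simp] theorem cliffordCodeOperator_permCode_one (n : ℕ) :
    cliffordCodeOperator (permCode (1 : Equiv.Perm (Fin t))) n = 1 := by
  ext x y
  rw [cliffordCodeOperator_apply_eq_ite, Matrix.one_apply]
  simp only [mem_permCode, Equiv.Perm.one_def, Equiv.refl_symm, Equiv.coe_refl, Function.comp_id]
  congr 1
  rw [eq_iff_forall_slices_eq (x := x) (y := y)]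
  simp only [eq_iff_iff]
  rfl

/-! ### Defect subspaces -/

/-- The **left defect subspace** `T_{LD} = {x : (x, 0) ∈ T}` of `T`.
[cite: GrossNezamiWalter2021, §4.2 (Prop. on defect subspaces, T_{LD})] -/
def leftDefect (T : Finset (QReg t × QReg t)) : Finset (QReg t) :=
  Finset.univ.filter fun x => (x, (fun _ => false)) ∈ T

/-- The **right defect subspace** `T_{RD} = {y : (0, y) ∈ T}` of `T`.
[cite: GrossNezamiWalter2021, §4.2 (Prop. on defect subspaces, T_{RD})] -/
def rightDefect (T : Finset (QReg t × QReg t)) : Finset (QReg t) :=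
  Finset.univ.filter fun y => ((fun _ => false), y) ∈ T

/-- Membership in `T_{LD}`. [cite: GrossNezamiWalter2021, §4.2 (defect subspaces, T_{LD})] -/
@[simp] theorem mem_leftDefect {T : Finset (QReg t × QReg t)} {x : QReg t} :
    x ∈ leftDefect T ↔ (x, (fun _ => false)) ∈ T := by
  simp [leftDefect]

/-- Membership in `T_{RD}`. [cite: GrossNezamiWalter2021, §4.2 (defect subspaces, T_{RD})] -/
@[simp] theorem mem_rightDefect {T : Finset (QReg t × QReg t)} {y : QReg t} :
    y ∈ rightDefect T ↔ ((fun _ => false), y) ∈ T := by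
  simp [rightDefect]

/-- `0 ∈ T_{LD}` and `0 ∈ T_{RD}` for `T ∈ Σ_{t,t}`. [folklore] -/
theorem zero_mem_leftDefect_and_rightDefect {T : Finset (QReg t × QReg t)}
    (hT : IsStochasticLagrangian T) :
    (fun _ => false) ∈ leftDefect T ∧ (fun _ => false) ∈ rightDefect T :=
  ⟨mem_leftDefect.2 hT.zero_mem, mem_rightDefect.2 hT.zero_mem⟩

/-- The right defect subspace of `T` is the left defect subspace of its swap. [folklore] -/
theorem rightDefect_eq_leftDefect_map (T : Finset (QReg t × QReg t)) :
    rightDefect T = leftDefect (T.map (Equiv.prodComm (QReg t) (QReg t)).toEmbedding) := by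
  ext y
  simp [Finset.mem_map_equiv]

/-! ### The tensor power action `C ↦ C^{⊗t}` and the commutant -/

/-- The `t`-th **tensor power action** `C ↦ C^{⊗t}` of an `n`-qubit operator on `t` copies,
realised on `QReg (t * n)` in the layout (copy `j`, qubit `i`) `↦ finProdFinEquiv (j, i)`:
entry `(x, y) ↦ ∏_{j<t} C_{x_{j,·}, y_{j,·}}`. [cite: GrossNezamiWalter2021, §4.1 ("t-th tensor power action", Thm. 4.3)] -/
def tensorPowerAction (t : ℕ) {n : ℕ} (C : Matrix (QReg n) (QReg n) ℂ) :
    Matrix (QReg (t * n)) (QReg (t * n)) ℂ :=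
  Matrix.of fun x y => ∏ j : Fin t,
    C (fun i => x (finProdFinEquiv (j, i))) (fun i => y (finProdFinEquiv (j, i)))

/-- Entries of `C^{⊗t}`: `∏_j C_{x_j, y_j}` over the copies. [folklore] -/
@[simp] theorem tensorPowerAction_apply (t : ℕ) (C : Matrix (QReg n) (QReg n) ℂ)
    (x y : QReg (t * n)) :
    tensorPowerAction t C x y = ∏ j : Fin t, C (copies t n x j) (copies t n y j) := rfl

/-- `1^{⊗t} = 1`. [folklore] -/
@[simp] theorem tensorPowerAction_one (t n : ℕ) :
    tensorPowerAction t (1 : Matrix (QReg n) (QReg n) ℂ) = 1 := by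
  ext x y
  rw [tensorPowerAction_apply, Matrix.one_apply]
  simp only [Matrix.one_apply]
  rw [Fintype.prod_boole]
  congr 1
  rw [eq_iff_forall_copies_eq (x := x) (y := y)]
  simp only [eq_iff_iff]
  rfl

/-- `(C D)^{⊗t} = C^{⊗t} D^{⊗t}`: the tensor power action is multiplicative. [folklore] -/
theorem tensorPowerAction_mul (t : ℕ) (C D : Matrix (QReg n) (QReg n) ℂ) :
    tensorPowerAction t (C * D) = tensorPowerAction t C * tensorPowerAction t D := by
  ext x z
  simp only [tensorPowerAction_apply, Matrix.mul_apply]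
  rw [Fintype.prod_sum]
  refine Fintype.sum_equiv (copies t n).symm _ _ fun W => ?_
  rw [← Finset.prod_mul_distrib]
  refine Finset.prod_congr rfl fun j _ => ?_
  have h : copies t n ((copies t n).symm W) j = W j := congrFun ((copies t n).apply_symm_apply W) j
  rw [h]

/-- The tensor power action as a monoid homomorphism
`Matrix (QReg n) (QReg n) ℂ →* Matrix (QReg (t*n)) (QReg (t*n)) ℂ`. [folklore] -/
def tensorPowerActionHom (t n : ℕ) :
    Matrix (QReg n) (QReg n) ℂ →* Matrix (QReg (t * n)) (QReg (t * n)) ℂ where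
  toFun := tensorPowerAction t
  map_one' := tensorPowerAction_one t n
  map_mul' := tensorPowerAction_mul t

/-- The bundled hom is `tensorPowerAction`. [folklore] -/
@[simp] theorem tensorPowerActionHom_apply (t n : ℕ) (C : Matrix (QReg n) (QReg n) ℂ) :
    tensorPowerActionHom t n C = tensorPowerAction t C := rfl

/-- The **commutant of the `t`-th Clifford tensor power**: the subalgebra of operators on
`QReg (t * n)` commuting with `C^{⊗t}` for every `n`-qubit Clifford circuit `C ∈ cliffordCircuits n`
(Mathlib `Subalgebra.centralizer` of the image of `cliffordCircuits n` under `tensorPowerAction t`).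
[cite: GrossNezamiWalter2021, §4.1 (commutant of the t-th tensor power action, Thm. 4.3)] -/
def cliffordCommutant (t n : ℕ) : Subalgebra ℂ (Matrix (QReg (t * n)) (QReg (t * n)) ℂ) :=
  Subalgebra.centralizer ℂ
    (tensorPowerAction t '' (cliffordCircuits n : Set (Matrix (QReg n) (QReg n) ℂ)))

/-- `A` lies in the commutant iff `C^{⊗t} A = A C^{⊗t}` for every Clifford circuit `C`.
[cite: GrossNezamiWalter2021, §4.1 (commutant of the t-th tensor power action)] -/
theorem mem_cliffordCommutant_iff {t n : ℕ} {A : Matrix (QReg (t * n)) (QReg (t * n)) ℂ} :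
    A ∈ cliffordCommutant t n ↔
      ∀ C ∈ cliffordCircuits n, tensorPowerAction t C * A = A * tensorPowerAction t C := by
  simp [cliffordCommutant, Subalgebra.mem_centralizer_iff]

/-! ### The commutant theorem (named fact) -/

/-- **Gross–Nezami–Walter, commutant of Clifford tensor powers, qubit case** [GNW21, Thm. 4.3
(announced as Thm. 1.1); `d = 2`]. *Let `d` be a prime and `n ≥ t − 1`. Then the operators
`R(T) = r(T)^{⊗n}` for `T ∈ Σ_{t,t}(d)` are `∏_{k=0}^{t-2} (d^k + 1)` many linearly independent
operators that span the commutant of the `t`-th tensor power action of the Clifford group for `n`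
qudits.* Here for `d = 2`: for all `t, n` with `t - 1 ≤ n`, (i) `|Σ_{t,t}(2)| = ∏_{k<t-1} (2^k+1)`
[GNW21, Thm. 4.10], (ii) the family `T ↦ R(T)` over `Σ_{t,t}(2)` is `ℂ`-linearly independent
[GNW21, Lemma 4.7], (iii) its span is the commutant `cliffordCommutant t n` [GNW21, Lemma 4.5 and
Thm. 4.9]. A NAMED FACT (not proved here); the inclusion "span ⊆ commutant" is the elementary
Lemma 4.5. [cite: GrossNezamiWalter2021, Thm. 4.3] -/
def CliffordCommutantTheorem : Prop :=
  ∀ t n : ℕ, t - 1 ≤ n →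
    Nat.card {T : Finset (QReg t × QReg t) // IsStochasticLagrangian T} =
        ∏ k ∈ Finset.range (t - 1), (2 ^ k + 1) ∧
      LinearIndependent ℂ
        (fun T : {T : Finset (QReg t × QReg t) // IsStochasticLagrangian T} =>
          cliffordCodeOperator T.1 n) ∧
      Submodule.span ℂ
          (Set.range fun T : {T : Finset (QReg t × QReg t) // IsStochasticLagrangian T} =>
            cliffordCodeOperator T.1 n) =
        Subalgebra.toSubmodule (cliffordCommutant t n)

end Literature.Computability.QuantumComplexity
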